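import Literature.Analysis.Asymptotics.MonomialAmplitudeMoments
import Literature.Analysis.Calculus.ResolutionChartSum
import HarnessLib

/-!
# From one normal-crossing chart to monomial pieces over the unit cube (orthants, reflection, scaling)

The bookkeeping step between the chart sum of a resolution of singularities
(`Literature/Analysis/Calculus/ResolutionChartSum.lean`) and the monomial pieces consumed by the
sublevel/Laplace asymptotics of the tree (`SublevelLocalToGlobal`, `SublevelMonomialization`,
`MonomialPhase.powMeasure`): in ONE chart, where the phase is `af(u) · u^κ`, the boundary
inequalities are `aj_b(u) · u^{γ_b} ≥ 0` and the density is `ρ(u) ∏ |u_j|^{h_j}` on the open cube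
`‖u‖ < δ` (units `af, aj_b` continuous and nowhere zero, `ρ ≥ 0` continuous with `ρ(0) > 0`), the
weighted sublevel integral splits along the `2^d` orthants; the "bad" orthants (where some boundary
inequality fails) contribute nothing, and each good orthant, reflected to the positive one and
rescaled by `δ`, is a piece `∫_{A(y) y^κ ≤ t} σ(S y) ψ(y) dvol_{h+1}(y)` over the unit cube with a
continuous unit `A > 0`, a continuous amplitude `ψ ≥ 0` positive at the origin and a continuous map
`S` into the closed cube with `S 0 = 0` — Lin 2017, proof of Lemma 2.4 ("the boundary conditions
become monomial inequalities, so `𝓜_y` is the union of orthant neighbourhoods of `y`; the integral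
over `𝓜_y` is then the sum of integrals of the form `∫_{ℝ^d_{≥0}} …`"); Watanabe 2009, Remark 2.12.
Everything here is PROVED; no definitions, no named facts.

## References

* S. Lin, arXiv:1003.5338, proof of Lemma 2.4. [Lin2017]
* S. Watanabe, *Algebraic Geometry and Statistical Learning Theory* (2009), Remark 2.12.
  [WatanabeSumio2009]
-/

noncomputable section

open Set Filter Metric Function
open _root_.MeasureTheory _root_.Topology
open scoped ENNReal
open Literature.Analysis.Calculus.Resolution

namespace Literature.Analysis.Asymptotics.MonomialPhase

variable {d : ℕ}

/-! ## Clamping into the unit cube; sign constancy of units -/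

/-- A continuous retraction of `ℝ^d` onto the closed unit cube `[0,1]^d`, fixing it pointwise.
[folklore] -/
theorem exists_clamp01 :
    ∃ c : (Fin d → ℝ) → (Fin d → ℝ), Continuous c ∧ (∀ y, c y ∈ Icc (0 : Fin d → ℝ) 1) ∧
      (∀ y ∈ Icc (0 : Fin d → ℝ) 1, c y = y) ∧ c 0 = 0 := by
  refine ⟨fun y j => max 0 (min 1 (y j)), ?_, fun y => ?_, fun y hy => ?_, ?_⟩
  · exact continuous_pi fun j => continuous_const.max (continuous_const.min (continuous_apply j))
  · exact ⟨fun j => le_max_left _ _, fun j => max_le zero_le_one (min_le_left _ _)⟩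
  · funext j
    have h1 : 0 ≤ y j := hy.1 j
    have h2 : y j ≤ 1 := hy.2 j
    show max 0 (min 1 (y j)) = y j
    rw [min_eq_right h2, max_eq_right h1]
  · funext j
    simp

/-- A continuous nowhere-vanishing function on `ℝ^d` has the sign of its value at `0`:
`0 < a u * s ↔ 0 < a 0 * s` for every real `s`. [folklore] -/
theorem pos_mul_iff_of_ne_zero {a : (Fin d → ℝ) → ℝ} (ha : Continuous a) (ha0 : ∀ u, a u ≠ 0)
    (u : Fin d → ℝ) (s : ℝ) : 0 < a u * s ↔ 0 < a 0 * s := by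
  have key : ∀ v w : Fin d → ℝ, 0 < a v → 0 < a w := by
    intro v w hv
    by_contra hw
    push Not at hw
    have hmem : (0 : ℝ) ∈ Icc (a w) (a v) := ⟨hw, hv.le⟩
    obtain ⟨z, hz⟩ := intermediate_value_univ w v ha hmem
    exact ha0 z hz
  have hsign : (0 < a u ↔ 0 < a 0) := ⟨key u 0, key 0 u⟩
  have hsign' : (a u < 0 ↔ a 0 < 0) := by
    constructor
    · intro h; rcases lt_or_gt_of_ne (ha0 0) with h0 | h0
      · exact h0
      · exact absurd (key 0 u h0) (not_lt.2 h.le)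
    · intro h; rcases lt_or_gt_of_ne (ha0 u) with h0 | h0
      · exact h0
      · exact absurd (key u 0 h0) (not_lt.2 h.le)
  rcases lt_trichotomy s 0 with hs | rfl | hs
  · rw [mul_pos_iff, mul_pos_iff]
    simp only [hs, not_lt.2 hs.le, and_true, and_false, false_or]
    exact hsign'
  · simp
  · rw [mul_pos_iff, mul_pos_iff]
    simp only [hs, not_lt.2 hs.le, and_true, and_false, or_false]
    exact hsign

/-! ## Products along a diagonal rescaling -/

/-- `∏ⱼ (δ sⱼ yⱼ)^{nⱼ} = δ^{Σ n} (∏ sⱼ^{nⱼ}) ∏ yⱼ^{nⱼ}`. [folklore] -/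
theorem prod_diag_pow (δ : ℝ) (s y : Fin d → ℝ) (n : Fin d → ℕ) :
    ∏ j, (δ * s j * y j) ^ n j = δ ^ (∑ j, n j) * (∏ j, s j ^ n j) * ∏ j, y j ^ n j := by
  simp only [mul_pow, Finset.prod_mul_distrib, Finset.prod_pow_eq_pow_sum]

/-- `|∏ⱼ sⱼ^{nⱼ}| = 1` for signs `|sⱼ| = 1`. [folklore] -/
theorem abs_prod_sign_pow {s : Fin d → ℝ} (hs : ∀ j, |s j| = 1) (n : Fin d → ℕ) :
    |∏ j, s j ^ n j| = 1 := by
  rw [Finset.abs_prod]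
  simp only [abs_pow, hs, one_pow, Finset.prod_const_one]

/-! ## Set integrals against `⊗ⱼ yⱼ^{hⱼ} dyⱼ` on the unit cube -/

/-- `∫_E Φ d(⊗ⱼ vol_{hⱼ+1}) = ∫_{(0,1)^d ∩ E} (∏ⱼ yⱼ^{hⱼ}) Φ(y) dy` for natural exponents `hⱼ`
(`vol_ω = x^{ω-1} dx` on `(0,1]`, `MonomialPhase.powMeasure`). [folklore] -/
theorem setIntegral_pi_powMeasure_nat (h : Fin d → ℕ) {Es : Set (Fin d → ℝ)}
    (hEs : MeasurableSet Es) (Φ : (Fin d → ℝ) → ℝ) :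
    ∫ y in Es, Φ y ∂(Measure.pi fun j => powMeasure (((h j + 1 : ℕ) : ℝ))) =
      ∫ y in (Set.pi univ fun _ => Ioo (0 : ℝ) 1) ∩ Es, (∏ j, y j ^ h j) * Φ y := by
  have hw : ∀ j, (0 : ℝ) < ((h j + 1 : ℕ) : ℝ) := fun j => by positivity
  set D : Fin d → ℝ → ℝ≥0∞ := fun j x => ENNReal.ofReal (x ^ ((((h j + 1 : ℕ) : ℝ)) - 1))
    with hD
  have hDm : ∀ j, Measurable (D j) := fun j => by simp only [hD]; fun_prop
  set C : Set (Fin d → ℝ) := Set.pi univ fun _ => Ioc (0 : ℝ) 1 with hC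
  have hCm : MeasurableSet C := MeasurableSet.univ_pi fun _ => measurableSet_Ioc
  -- the product of the weights is a density on the cube
  have hpi : (Measure.pi fun j => powMeasure (((h j + 1 : ℕ) : ℝ))) =
      ((volume : Measure (Fin d → ℝ)).restrict C).withDensity fun y => ∏ j, D j (y j) := by
    have h1 : (fun j => powMeasure (((h j + 1 : ℕ) : ℝ))) =
        fun j => ((volume : Measure ℝ).restrict (Ioc 0 1)).withDensity (D j) := by
      funext j; rfl
    haveI : ∀ j, SigmaFinite (((volume : Measure ℝ).restrict (Ioc 0 1)).withDensity (D j)) :=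
      fun j => by
        haveI := isFiniteMeasure_powMeasure (hw j)
        show SigmaFinite (powMeasure (((h j + 1 : ℕ) : ℝ))); infer_instance
    rw [h1, pi_withDensity_fin (fun _ => (volume : Measure ℝ).restrict (Ioc 0 1)) D hDm]
    congr 1
    rw [hC, ← Measure.restrict_pi_pi, ← volume_pi]
  rw [hpi]
  have hF : Measurable fun y : Fin d → ℝ => ∏ j, D j (y j) :=
    Finset.measurable_prod _ fun j _ => (hDm j).comp (measurable_pi_apply j)
  have hrestr : (((volume : Measure (Fin d → ℝ)).restrict C).withDensity
      (fun y => ∏ j, D j (y j))).restrict Es =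
      ((volume : Measure (Fin d → ℝ)).restrict (Es ∩ C)).withDensity fun y => ∏ j, D j (y j) := by
    rw [restrict_withDensity hEs, Measure.restrict_restrict hEs]
  have hlt : ∀ᵐ y ∂((volume : Measure (Fin d → ℝ)).restrict (Es ∩ C)), (∏ j, D j (y j)) < ∞ :=
    ae_of_all _ fun y => ENNReal.prod_lt_top fun j _ => by simp only [hD]; exact ENNReal.ofReal_lt_top
  change ∫ y, Φ y ∂((((volume : Measure (Fin d → ℝ)).restrict C).withDensity
      (fun y => ∏ j, D j (y j))).restrict Es) = _
  rw [hrestr, integral_withDensity_eq_integral_toReal_smul hF hlt]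
  change ∫ y in Es ∩ C, (∏ j, D j (y j)).toReal • Φ y = _
  -- the cube `(0,1]^d` and the open cube agree a.e.
  have hCC' : (Set.pi univ fun _ : Fin d => Ioo (0 : ℝ) 1) =ᵐ[(volume : Measure (Fin d → ℝ))] C := by
    rw [volume_pi, hC]
    exact Measure.pi_Ioo_ae_eq_pi_Ioc
  have hsets : (Es ∩ C : Set (Fin d → ℝ)) =ᵐ[(volume : Measure (Fin d → ℝ))]
      ((Set.pi univ fun _ : Fin d => Ioo (0 : ℝ) 1) ∩ Es : Set (Fin d → ℝ)) := by
    rw [inter_comm]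
    exact hCC'.symm.inter (ae_eq_refl Es)
  rw [setIntegral_congr_set hsets]
  refine setIntegral_congr_fun ((MeasurableSet.univ_pi fun _ => measurableSet_Ioo).inter hEs)
    fun y hy => ?_
  have hy0 : ∀ j, 0 ≤ y j := fun j => by
    have := hy.1 j (mem_univ j); exact this.1.le
  rw [smul_eq_mul, ENNReal.toReal_prod]
  congr 1
  refine Finset.prod_congr rfl fun j _ => ?_
  simp only [hD]
  rw [ENNReal.toReal_ofReal (Real.rpow_nonneg (hy0 j) _),
    show (((h j + 1 : ℕ) : ℝ)) - 1 = ((h j : ℕ) : ℝ) by push_cast; ring, Real.rpow_natCast]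

/-! ## One chart ⇒ monomial pieces over the unit cube -/

set_option maxHeartbeats 1600000 in
-- a long bookkeeping proof (orthants × change of variables × identification of the pieces)
/-- **From one normal-crossing chart to monomial pieces** (Lin 2017, proof of Lemma 2.4: orthant
decomposition of a chart neighbourhood under monomial boundary inequalities; Watanabe 2009,
Remark 2.12). On the open cube `‖u‖ < δ` of `ℝ^d` let the phase be `af(u) u^κ`, the boundary
inequalities `aj_b(u) u^{γ_b} ≥ 0` (`b ∈ β` finite) and the density `ρ(u) ∏ |u_j|^{h_j}`, with
`af, aj_b` continuous and nowhere zero on `ℝ^d` and `ρ ≥ 0` continuous with `ρ 0 > 0`. Then there are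
finitely many pieces `i` (the good orthants) with continuous units `A_i > 0`, continuous
amplitudes `ψ_i ≥ 0` with `ψ_i 0 > 0` and continuous maps `S_i` into the closed cube with
`S_i 0 = 0` (reflection, clamping and scaling `y ↦ δ ε ⊙ y`) such that for every continuous test
function `σ` and every level `t`,
`∫_{‖u‖<δ, aj u^γ ≥ 0, |af u^κ| ≤ t} σ ρ ∏|u_j|^{h_j} du = ∑_i ∫_{A_i(y) y^κ ≤ t} σ(S_i y) ψ_i(y) dvol_{h+1}(y)`,
`vol_{h+1} = ⊗_j y_j^{h_j} dy_j` on `(0,1]` (`MonomialPhase.powMeasure`).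
[cite: Lin2017, proof of Lemma 2.4] [cite: WatanabeSumio2009, Remark 2.12] -/
theorem chartIntegral_eq_sum_pieces {β : Type*} [Fintype β] {δ : ℝ} (hδ : 0 < δ)
    (κ h : Fin d → ℕ) (γ : β → Fin d → ℕ) {af ρ : (Fin d → ℝ) → ℝ} {aj : β → (Fin d → ℝ) → ℝ}
    (haf : Continuous af) (haf0 : ∀ u, af u ≠ 0) (haj : ∀ b, Continuous (aj b))
    (haj0 : ∀ b u, aj b u ≠ 0) (hρ : Continuous ρ) (hρ0 : ∀ u, 0 ≤ ρ u) (hρpos : 0 < ρ 0) :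
    ∃ (ι : Type) (_ : Fintype ι) (A ψ : ι → (Fin d → ℝ) → ℝ) (S : ι → (Fin d → ℝ) → (Fin d → ℝ)),
      (∀ i, Continuous (A i)) ∧ (∀ i y, 0 < A i y) ∧ (∀ i, Continuous (ψ i)) ∧
      (∀ i y, 0 ≤ ψ i y) ∧ (∀ i, 0 < ψ i 0) ∧ (∀ i, Continuous (S i)) ∧ (∀ i, S i 0 = 0) ∧
      (∀ i y, ‖S i y‖ ≤ δ) ∧
      ∀ σ : (Fin d → ℝ) → ℝ, Continuous σ → ∀ t : ℝ,
        ∫ u in {u ∈ ball (0 : Fin d → ℝ) δ | (∀ b, 0 ≤ aj b u * ∏ j, u j ^ γ b j) ∧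
            |af u * ∏ j, u j ^ κ j| ≤ t}, σ u * ρ u * ∏ j, |u j| ^ h j
        = ∑ i, ∫ y in {y | A i y * ∏ j, y j ^ κ j ≤ t}, σ (S i y) * ψ i y
            ∂(Measure.pi fun j => powMeasure (((h j + 1 : ℕ) : ℝ))) := by
  classical
  obtain ⟨c, hcc, hc01, hcid, hc0⟩ := exists_clamp01 (d := d)
  -- signs and the diagonal rescalings of the orthants
  set sg : (Fin d → Bool) → Fin d → ℝ := fun ε j => if ε j then 1 else -1 with hsg
  have hsg_abs : ∀ ε j, |sg ε j| = 1 := fun ε j => by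
    simp only [hsg]; split_ifs <;> simp
  have hsg_ne : ∀ ε j, sg ε j ≠ 0 := fun ε j => by
    intro h0; have := hsg_abs ε j; rw [h0, abs_zero] at this; exact zero_ne_one this
  have hsg_sq : ∀ ε j, sg ε j * sg ε j = 1 := fun ε j => by
    simp only [hsg]; split_ifs <;> norm_num
  set L : (Fin d → Bool) → (Fin d → ℝ) → (Fin d → ℝ) := fun ε y j => δ * sg ε j * y j with hL
  have hLc : ∀ ε, Continuous (L ε) := fun ε =>
    continuous_pi fun j => continuous_const.mul (continuous_apply j)
  have hL0 : ∀ ε, L ε 0 = 0 := fun ε => by funext j; simp [hL]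
  have hLnorm : ∀ ε y, (∀ j, |y j| ≤ 1) → ‖L ε y‖ ≤ δ := by
    intro ε y hy
    rw [pi_norm_le_iff_of_nonneg hδ.le]
    intro j
    rw [Real.norm_eq_abs]
    show |δ * sg ε j * y j| ≤ δ
    rw [abs_mul, abs_mul, abs_of_pos hδ, hsg_abs, mul_one]
    exact mul_le_of_le_one_right hδ.le (hy j)
  -- the continuous linear version and its determinant
  set Lc : (Fin d → Bool) → (Fin d → ℝ) →L[ℝ] (Fin d → ℝ) := fun ε =>
    LinearMap.toContinuousLinearMap (Matrix.toLin' (Matrix.diagonal fun j => δ * sg ε j)) with hLcdef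
  have hLcL : ∀ ε y, Lc ε y = L ε y := fun ε y => by
    funext j
    simp only [hLcdef, hL, LinearMap.coe_toContinuousLinearMap', Matrix.toLin'_apply,
      Matrix.mulVec_diagonal]
  have hLdet : ∀ ε, |(Lc ε).det| = δ ^ d := fun ε => by
    have : (Lc ε).det = ∏ j, δ * sg ε j := by
      simp only [hLcdef, ContinuousLinearMap.det, LinearMap.coe_toContinuousLinearMap,
        LinearMap.det_toLin', Matrix.det_diagonal]
    rw [this, Finset.abs_prod]
    simp only [abs_mul, abs_of_pos hδ, hsg_abs, mul_one, Finset.prod_const, Finset.card_univ,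
      Fintype.card_fin]
  have hLinj : ∀ ε, Injective (L ε) := fun ε y y' hyy => by
    funext j
    have := congr_fun hyy j
    simp only [hL] at this
    exact mul_left_cancel₀ (mul_ne_zero hδ.ne' (hsg_ne ε j)) this
  have hLsurj : ∀ ε, Surjective (L ε) := fun ε u =>
    ⟨fun j => u j / (δ * sg ε j), by
      funext j
      show δ * sg ε j * (u j / (δ * sg ε j)) = u j
      rw [mul_comm, div_mul_cancel₀ _ (mul_ne_zero hδ.ne' (hsg_ne ε j))]⟩
  -- good orthants and the pieces
  set good : (Fin d → Bool) → Prop := fun ε => ∀ b, 0 < aj b 0 * ∏ j, sg ε j ^ γ b j with hgood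
  set A : (Fin d → Bool) → (Fin d → ℝ) → ℝ := fun ε y => |af (L ε (c y))| * δ ^ (∑ j, κ j) with hA
  set ψ : (Fin d → Bool) → (Fin d → ℝ) → ℝ := fun ε y =>
    ρ (L ε (c y)) * (δ ^ (∑ j, h j) * δ ^ d) with hψ
  set S : (Fin d → Bool) → (Fin d → ℝ) → (Fin d → ℝ) := fun ε y => L ε (c y) with hS
  have hLcc : ∀ ε, Continuous fun y => L ε (c y) := fun ε => (hLc ε).comp hcc
  refine ⟨{ε // good ε}, inferInstance, fun i => A i, fun i => ψ i, fun i => S i,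
    fun i => (continuous_abs.comp (haf.comp (hLcc i))).mul continuous_const,
    fun i y => mul_pos (abs_pos.2 (haf0 _)) (pow_pos hδ _),
    fun i => (hρ.comp (hLcc i)).mul continuous_const,
    fun i y => mul_nonneg (hρ0 _) (by positivity),
    fun i => ?_, fun i => hLcc i, fun i => by simp only [hS, hc0, hL0], fun i y => ?_, ?_⟩
  · simp only [hψ, hc0, hL0]
    exact mul_pos hρpos (by positivity)
  · exact hLnorm i (c y) fun j => by
      have h1 : 0 ≤ c y j := (hc01 y).1 j
      have h2 : c y j ≤ 1 := (hc01 y).2 j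
      exact abs_le.2 ⟨by linarith, h2⟩
  -- the identity
  intro σ hσ t
  set X : (Fin d → ℝ) → ℝ := fun u => σ u * ρ u * ∏ j, |u j| ^ h j with hX
  have hXc : Continuous X := (hσ.mul hρ).mul
    (continuous_finsetProd _ fun j _ => (continuous_abs.comp (continuous_apply j)).pow _)
  set constr : (Fin d → ℝ) → Prop := fun u => ∀ b, 0 ≤ aj b u * ∏ j, u j ^ γ b j with hconstr
  set level : (Fin d → ℝ) → Prop := fun u => |af u * ∏ j, u j ^ κ j| ≤ t with hlevel
  set E : Set (Fin d → ℝ) := {u ∈ ball (0 : Fin d → ℝ) δ | constr u ∧ level u} with hE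
  have hconstr_closed : IsClosed {u | constr u} := by
    simp only [hconstr, setOf_forall]
    exact isClosed_iInter fun b => isClosed_le continuous_const
      ((haj b).mul (continuous_finsetProd _ fun j _ => (continuous_apply j).pow _))
  have hlevel_closed : IsClosed {u | level u} :=
    isClosed_le (continuous_abs.comp (haf.mul
      (continuous_finsetProd _ fun j _ => (continuous_apply j).pow _))) continuous_const
  have hEm : MeasurableSet E :=
    isOpen_ball.measurableSet.inter (hconstr_closed.measurableSet.inter hlevel_closed.measurableSet)
  have hEball : E ⊆ ball 0 δ := fun u hu => hu.1
  have hXint : ∀ s ⊆ ball (0 : Fin d → ℝ) δ, IntegrableOn X s := fun s hs =>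
    ((hXc.continuousOn.integrableOn_compact (isCompact_closedBall (0 : Fin d → ℝ) δ))).mono_set
      (hs.trans ball_subset_closedBall)
  -- Step 1: remove the coordinate hyperplanes
  set Oε : (Fin d → Bool) → Set (Fin d → ℝ) := fun ε => {u | ∀ j, 0 < sg ε j * u j} with hOε
  have hOo : ∀ ε, IsOpen (Oε ε) := fun ε => by
    simp only [hOε, setOf_forall]
    exact isOpen_iInter_of_finite fun j => isOpen_lt continuous_const
      (continuous_const.mul (continuous_apply j))
  have hdisj : Pairwise (Disjoint on fun ε => E ∩ Oε ε) := by
    intro ε ε' hne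
    rw [Function.onFun, disjoint_left]
    rintro u ⟨-, hu⟩ ⟨-, hu'⟩
    apply hne; funext j
    have h12 : 0 < (sg ε j * sg ε' j) * (u j * u j) := by
      have := mul_pos (hu j) (hu' j)
      calc (0 : ℝ) < sg ε j * u j * (sg ε' j * u j) := this
        _ = (sg ε j * sg ε' j) * (u j * u j) := by ring
    have hss : 0 < sg ε j * sg ε' j := pos_of_mul_pos_left h12 (mul_self_nonneg _)
    by_contra hj
    have : sg ε j * sg ε' j = -1 := by
      simp only [hsg]
      cases hb : ε j <;> cases hb' : ε' j
      · exact absurd (hb.trans hb'.symm) hj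
      · norm_num
      · norm_num
      · exact absurd (hb.trans hb'.symm) hj
    rw [this] at hss
    linarith
  have hcover : E ∩ {u | ∀ j, u j ≠ 0} = ⋃ ε, E ∩ Oε ε := by
    ext u
    simp only [mem_inter_iff, mem_setOf_eq, mem_iUnion]
    constructor
    · rintro ⟨huE, hu⟩
      refine ⟨fun j => decide (0 < u j), huE, fun j => ?_⟩
      by_cases hj : 0 < u j
      · simp [hsg, hj]
      · have : u j < 0 := lt_of_le_of_ne (not_lt.1 hj) (hu j)
        simp [hsg, hj]; linarith
    · rintro ⟨ε, huE, hu⟩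
      refine ⟨huE, fun j h0 => ?_⟩
      have := hu j; rw [h0, mul_zero] at this; exact lt_irrefl _ this
  have hstep1 : ∫ u in E, X u = ∑ ε, ∫ u in E ∩ Oε ε, X u := by
    rw [setIntegral_eq_of_zero_off_hyperplanes (T := E ∩ {u | ∀ j, u j ≠ 0}) hEm
      inter_subset_left (fun u hu _ => by
        by_contra hall; push Not at hall; exact hu.2 ⟨hu.1, hall⟩), hcover]
    exact integral_iUnion_fintype (fun ε => hEm.inter (hOo ε).measurableSet) hdisj
      fun ε => hXint _ (inter_subset_left.trans hEball)
  -- Step 2: change of variables in each orthant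
  have hstep2 : ∀ ε, ∫ u in E ∩ Oε ε, X u = ∫ y in L ε ⁻¹' (E ∩ Oε ε), δ ^ d * X (L ε y) := by
    intro ε
    have hpre : MeasurableSet (L ε ⁻¹' (E ∩ Oε ε)) :=
      (hEm.inter (hOo ε).measurableSet).preimage (hLc ε).measurable
    have himg : (Lc ε : (Fin d → ℝ) → (Fin d → ℝ)) '' (L ε ⁻¹' (E ∩ Oε ε)) = E ∩ Oε ε := by
      have : (Lc ε : (Fin d → ℝ) → (Fin d → ℝ)) = L ε := funext (hLcL ε)
      rw [this, image_preimage_eq _ (hLsurj ε)]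
    have h1 : ∫ u in E ∩ Oε ε, X u =
        ∫ u in (Lc ε : (Fin d → ℝ) → (Fin d → ℝ)) '' (L ε ⁻¹' (E ∩ Oε ε)), X u := by rw [himg]
    rw [h1, integral_image_eq_integral_abs_det_fderiv_smul volume hpre
      (fun y _ => (Lc ε).hasFDerivAt.hasFDerivWithinAt)
      (by rw [show ((Lc ε : (Fin d → ℝ) → (Fin d → ℝ))) = L ε from funext (hLcL ε)]
          exact (hLinj ε).injOn)]
    refine setIntegral_congr_fun hpre fun y _ => ?_
    rw [hLdet ε, smul_eq_mul, hLcL]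
  -- Step 3: the preimage of an orthant piece and the integrand on it
  set C' : Set (Fin d → ℝ) := Set.pi univ fun _ => Ioo (0 : ℝ) 1 with hC'
  set Elev : (Fin d → Bool) → Set (Fin d → ℝ) := fun ε => {y | A ε y * ∏ j, y j ^ κ j ≤ t}
    with hElev
  have hmemC' : ∀ y, y ∈ C' ↔ ∀ j, 0 < y j ∧ y j < 1 := fun y => by
    simp only [hC', mem_univ_pi, mem_Ioo]
  have hcC' : ∀ y ∈ C', c y = y := fun y hy =>
    hcid y ⟨fun j => ((hmemC' y).1 hy j).1.le, fun j => ((hmemC' y).1 hy j).2.le⟩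
  have hball_iff : ∀ ε y, L ε y ∈ ball (0 : Fin d → ℝ) δ ↔ ∀ j, |y j| < 1 := by
    intro ε y
    rw [mem_ball_zero_iff, pi_norm_lt_iff hδ]
    refine forall_congr' fun j => ?_
    show |δ * sg ε j * y j| < δ ↔ |y j| < 1
    rw [abs_mul, abs_mul, abs_of_pos hδ, hsg_abs, mul_one]
    constructor
    · intro h; by_contra h'; push Not at h'
      exact absurd h (not_lt.2 (le_mul_of_one_le_right hδ.le h'))
    · intro h; calc δ * |y j| < δ * 1 := mul_lt_mul_of_pos_left h hδ
        _ = δ := mul_one δ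
  have hO_iff : ∀ ε y, L ε y ∈ Oε ε ↔ ∀ j, 0 < y j := by
    intro ε y
    refine forall_congr' fun j => ?_
    show 0 < sg ε j * (δ * sg ε j * y j) ↔ 0 < y j
    rw [show sg ε j * (δ * sg ε j * y j) = δ * (sg ε j * sg ε j) * y j by ring, hsg_sq, mul_one]
    exact mul_pos_iff_of_pos_left hδ
  have hpre_iff : ∀ ε y, y ∈ L ε ⁻¹' (E ∩ Oε ε) ↔ y ∈ C' ∧ constr (L ε y) ∧ level (L ε y) := by
    intro ε y
    simp only [mem_preimage, mem_inter_iff, hE, mem_setOf_eq, hball_iff, hmemC']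
    constructor
    · rintro ⟨⟨hb, hc, hl⟩, ho⟩
      rw [hO_iff] at ho
      exact ⟨fun j => ⟨ho j, (abs_lt.1 (hb j)).2⟩, hc, hl⟩
    · rintro ⟨hy, hc, hl⟩
      refine ⟨⟨fun j => abs_lt.2 ⟨by linarith [(hy j).1], (hy j).2⟩, hc, hl⟩, ?_⟩
      rw [hO_iff]; exact fun j => (hy j).1
  have hconstrL : ∀ ε, ∀ y ∈ C', (constr (L ε y) ↔ good ε) := by
    intro ε y hy
    have hypos : ∀ j, 0 < y j := fun j => ((hmemC' y).1 hy j).1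
    refine forall_congr' fun b => ?_
    have hP : 0 < δ ^ (∑ j, γ b j) * ∏ j, y j ^ γ b j :=
      mul_pos (pow_pos hδ _) (Finset.prod_pos fun j _ => pow_pos (hypos j) _)
    have hQ : aj b (L ε y) * ∏ j, sg ε j ^ γ b j ≠ 0 :=
      mul_ne_zero (haj0 b _) (fun h0 => by
        have := abs_prod_sign_pow (hsg_abs ε) (γ b); rw [h0, abs_zero] at this
        exact zero_ne_one this)
    show (0 ≤ aj b (L ε y) * ∏ j, (δ * sg ε j * y j) ^ γ b j) ↔ 0 < aj b 0 * ∏ j, sg ε j ^ γ b j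
    rw [prod_diag_pow, show aj b (L ε y) * ((δ ^ (∑ j, γ b j)) * (∏ j, sg ε j ^ γ b j) *
        ∏ j, y j ^ γ b j) = (aj b (L ε y) * ∏ j, sg ε j ^ γ b j) *
        ((δ ^ (∑ j, γ b j)) * ∏ j, y j ^ γ b j) by ring,
      mul_nonneg_iff_of_pos_right hP, ← pos_mul_iff_of_ne_zero (haj b) (haj0 b) (L ε y)]
    exact ⟨fun h0 => lt_of_le_of_ne h0 hQ.symm, le_of_lt⟩
  have hlevelL : ∀ ε, ∀ y ∈ C', (level (L ε y) ↔ y ∈ Elev ε) := by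
    intro ε y hy
    have hy0 : ∀ j, 0 ≤ y j := fun j => ((hmemC' y).1 hy j).1.le
    have hprod0 : 0 ≤ ∏ j, y j ^ κ j := Finset.prod_nonneg fun j _ => pow_nonneg (hy0 j) _
    show |af (L ε y) * ∏ j, (δ * sg ε j * y j) ^ κ j| ≤ t ↔
      |af (L ε (c y))| * δ ^ (∑ j, κ j) * ∏ j, y j ^ κ j ≤ t
    rw [hcC' y hy, prod_diag_pow, abs_mul, abs_mul, abs_mul, abs_prod_sign_pow (hsg_abs ε),
      abs_of_pos (pow_pos hδ _), abs_of_nonneg hprod0,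
      show |af (L ε y)| * ((δ ^ (∑ j, κ j)) * 1 * ∏ j, y j ^ κ j) =
        |af (L ε y)| * (δ ^ (∑ j, κ j)) * ∏ j, y j ^ κ j by ring]
  have hXL : ∀ ε, ∀ y ∈ C', δ ^ d * X (L ε y) = (∏ j, y j ^ h j) * (σ (S ε y) * ψ ε y) := by
    intro ε y hy
    have hy0 : ∀ j, 0 ≤ y j := fun j => ((hmemC' y).1 hy j).1.le
    have habs : ∏ j, |L ε y j| ^ h j = δ ^ (∑ j, h j) * ∏ j, y j ^ h j := by
      have : ∀ j, |L ε y j| = δ * (1 : ℝ) * y j := fun j => by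
        show |δ * sg ε j * y j| = δ * 1 * y j
        rw [abs_mul, abs_mul, abs_of_pos hδ, hsg_abs, abs_of_nonneg (hy0 j)]
      calc ∏ j, |L ε y j| ^ h j = ∏ j, (δ * (1 : ℝ) * y j) ^ h j :=
            Finset.prod_congr rfl fun j _ => by rw [this]
        _ = δ ^ (∑ j, h j) * (∏ j, (1 : ℝ) ^ h j) * ∏ j, y j ^ h j := prod_diag_pow δ (fun _ => 1) y h
        _ = δ ^ (∑ j, h j) * ∏ j, y j ^ h j := by simp
    simp only [hX, hS, hψ, hcC' y hy, habs]
    ring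
  -- Step 4: bad orthants do not contribute; good ones are the pieces
  have hbad : ∀ ε, ¬ good ε → ∫ y in L ε ⁻¹' (E ∩ Oε ε), δ ^ d * X (L ε y) = 0 := by
    intro ε hε
    have : L ε ⁻¹' (E ∩ Oε ε) = ∅ := by
      ext y
      simp only [mem_empty_iff_false, iff_false]
      intro hy
      obtain ⟨hyC, hc, -⟩ := (hpre_iff ε y).1 hy
      exact hε ((hconstrL ε y hyC).1 hc)
    rw [this, Measure.restrict_empty, integral_zero_measure]
  have hgoodpiece : ∀ ε, good ε → ∫ y in L ε ⁻¹' (E ∩ Oε ε), δ ^ d * X (L ε y) =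
      ∫ y in C' ∩ Elev ε, (∏ j, y j ^ h j) * (σ (S ε y) * ψ ε y) := by
    intro ε hε
    have hset : L ε ⁻¹' (E ∩ Oε ε) = C' ∩ Elev ε := by
      ext y
      rw [hpre_iff]
      constructor
      · rintro ⟨hyC, -, hl⟩; exact ⟨hyC, (hlevelL ε y hyC).1 hl⟩
      · rintro ⟨hyC, hl⟩; exact ⟨hyC, (hconstrL ε y hyC).2 hε, (hlevelL ε y hyC).2 hl⟩
    rw [hset]
    have hm : MeasurableSet (C' ∩ Elev ε) := by
      refine (MeasurableSet.univ_pi fun _ => measurableSet_Ioo).inter ?_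
      exact (isClosed_le (((continuous_abs.comp (haf.comp (hLcc ε))).mul continuous_const).mul
        (continuous_finsetProd _ fun j _ => (continuous_apply j).pow _))
        continuous_const).measurableSet
    exact setIntegral_congr_fun hm fun y hy => hXL ε y hy.1
  -- Step 5: assemble
  have hElev_m : ∀ ε, MeasurableSet (Elev ε) := fun ε =>
    (isClosed_le (((continuous_abs.comp (haf.comp (hLcc ε))).mul continuous_const).mul
      (continuous_finsetProd _ fun j _ => (continuous_apply j).pow _)) continuous_const).measurableSet
  calc ∫ u in E, X u = ∑ ε, ∫ u in E ∩ Oε ε, X u := hstep1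
    _ = ∑ ε, ∫ y in L ε ⁻¹' (E ∩ Oε ε), δ ^ d * X (L ε y) := Finset.sum_congr rfl fun ε _ => hstep2 ε
    _ = ∑ i : {ε // good ε}, ∫ y in L i ⁻¹' (E ∩ Oε i), δ ^ d * X (L i y) := by
        rw [← Finset.sum_filter_of_ne (s := Finset.univ) (p := good)
          (fun ε _ hne => by by_contra hε; exact hne (hbad ε hε)),
          Finset.sum_subtype (p := good) (Finset.univ.filter good) (fun ε => by simp)]
    _ = ∑ i : {ε // good ε}, ∫ y in Elev i, σ (S i y) * ψ i y
          ∂(Measure.pi fun j => powMeasure (((h j + 1 : ℕ) : ℝ))) := by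
        refine Finset.sum_congr rfl fun i _ => ?_
        rw [hgoodpiece i i.2, setIntegral_pi_powMeasure_nat h (hElev_m i)]

end Literature.Analysis.Asymptotics.MonomialPhase

end
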